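import Summits.QuantumFields.BalabanUV.T4Continuum.Spine.NE2BalabanFinalRateCarriers

/-!
# T⁴ programme — ROW NE5's END FACES AND THE W1 MINIMISER SPLIT FOR BAŁABAN's TYPED TIER-B OPERATOR AT ANY HONEST NE3 RATE
# (row NE5 owner's junction with row NE2's PART 5 `Spine/NE2BalabanFinalRateCarriers`, p219406)

Cell `pub-balaban`, unit `b2b-balaban-t4-ne5-p1` (row NE5 OWNER, gen 33; journal INTENT «g33-a»).  Summits-side NEW WORK under the LEAN
PLACEMENT RULE (bookkeeping on the cell's own models; NOT a Literature module; print is cited for KIND only).  HONEST FRAMING: rung (B)+1 of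
the FINITE-VOLUME T⁴ continuum programme — NOT infinite volume, NOT a mass gap, NOT the Clay problem, NOT a proof of NE5 (NOT PRINTED:
[Balaban1987RG1]–[Balaban1989LargeFieldII] print ε-UNIFORM bounds — B13 (2.38)–(2.41), B14 (2.40)–(2.42), B16 (1.99) — never two-spacing
η-RATES; GAPS G-t4-U3-1), NOT a proof of NE2 or NE3.  HONEST DEPENDENCY (cell, verbatim): continuum YM on T⁴ ⇐ BetaPertH ∧ nine spine
estimates (0/9 proved); BetaPertH ⇐ (D1) ∧ (D4) ∧ CAP+tail; G-an2-4 gates asym, D1 and NE2/3/4.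

WHAT THIS FILE DOES (no new estimate; constants = the record's, letter for letter).  `Support/OutputRateTowerBalaban` (row NE2's leaf-08,
the «B7 × NE5 junction») gives row NE5's W1 carrier law `TowerLaw … L⁻¹` and the END `ne5_at_of_balaban_lip_readsIns_nat` for Bałaban's
TYPED TIER-B operator `Δ_a ⊗ 1 + P_B(Rg)` at King's rate `L⁻¹`, i.e. with node NE3's `LocalRate … C L⁻¹` as the one upstream binder of W1
type.  Row NE2's PART 4∕PART 5 (`Spine/NE2BalabanFinalRate`, `Spine/NE2BalabanFinalRateCarriers`) since made the law RATE-GENERIC: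
`towerLaw_balaban_final_of_regular_rate` (θ ∈ [L⁻¹, 1]), `…_anyRate` (0 ≤ θ ≤ 1 ↦ rate `max θ L⁻¹`), and on NE3's own carrier
`MinimalActionRate.minActReadings …` the faces `towerLaw_balaban_final_of_minActReadings_rate` ∕ `towerLaw_balaban_final_of_ne3Shape_anyRate`
(node U1b's FULL shape `T4EtaRateMin.NE3Shape`, which carries its own honest rate).  This file is the NE5 side of that junction:

§1 `ne5_at_of_balaban_lip_readsIns_rate_nat` — the END for every θ ∈ [L⁻¹, 1] (per-member `LocalRate … C θ`), and
   `ne5_at_of_balaban_lip_readsIns_anyRate_nat` — the END for every 0 ≤ θ ≤ 1 at the rate `max θ L⁻¹` (socket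
   `OutputRateTowerSocket.ne5_at_of_towerLaw_lip_readsIns_nat` BY NAME; W4 PRODUCED by the same-data insertion reading).
§2 on NE3's carrier: `operatorRate_of_balaban_split_minActReadings_rate` — W1 by the minimiser split with ONE binder `LocalRate (minActReadings …)
   C θ` feeding BOTH legs ⟹ `OperatorRate W (cR·Cpert∕r₀ + Λb·C) θ`; `operatorRate_of_balaban_split_ne3Shape` — the same from `NE3Shape
   (minActReadings …) C θ` at the rate `max θ L⁻¹`: NO rate binder and NO binder of NE2 type is left.
§3 the ENDs by the split: `ne5_at_of_balaban_split_readsIns_rate_nat` and `ne5_at_of_balaban_split_readsIns_ne3Shape_nat` (socket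
   `ne5_at_of_towerLaw_split_readsIns_nat` BY NAME).

VALUE (bookkeeping).  On the TOWER-READING road (operator species read from the lifted King-averaged towers, `ReadsTower`∕`ReadsTowerMid`) the
NE5 END now displays EXACTLY ONE upstream analytic binder of W1 type — node U1b's `NE3Shape` on NE3's own carrier (OPEN, displayed) — for
EVERY honest NE3 rate θ ∈ [0, 1), rows NE2's ROOT B ∕ PART 4 ∕ PART 5 having discharged the NE2 half BY NAME; NE5's output rate is then
any θ′ with `max θ L⁻¹ ≤ θ′ ≤ 1` and `ω + Λc < θ′` (S, sharp: `T4InputCauchyRateSharp.sharp_ne5_iff`).  The END-OF-RECORD road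
(`B13StepEndInsOp.ne5_of_record_insOp`, W1 in the ENTRY currency `WeightedEntrywiseRate`) is NOT touched: an operator-norm tower increment
packages into a decaying-weight entry format only with the loss `1 ∕ min wt` (`B13OpDatumJunctions` §1), so this junction is the
tower-reading road's, as its parents are.  The remaining binders are the row's leaves BY NAME (`t4/formal/NE5/LEAVES.md`): readings
`ReadsTower`∕`ReadsTowerMid`∕`ReadsIns`, the [I]-type margin floor `r₀`, MI-R `RepresentsA∕B`, base `InBase`, W2 `DataLipschitz`, W2-ins
`InsOpEnvelope`∕`InsBoundA`, W3 `InsertionDampedNat`, the quoted levels `DecayBound` (L05∕L06), R (`hreach`, `hnear`, `hfirst`), S (`hsmall`),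
the (3.35)-class `RegularTransporters` + the one explicit threshold `α, β ≤ η ≤ etaStar o d a a′` of ROOT B, and the background-Lipschitz leg
`hLip`∕`hdom` of the split.  Model level (no B0); `Rg` DATA.  `FlowStep.BetaPertH`, (B), (B^μ) do not occur.  ABSOLUTE RULE kept; no
`def … : Prop` fact; no new definition; 0 sorry.
-/

noncomputable section

open scoped BigOperators ComplexConjugate Matrix Matrix.Norms.L2Operator Kronecker

namespace Summit.QuantumFields.BalabanUV.T4Continuum.OutputRateTowerBalabanRate

open Literature.MathematicalPhysics.QuantumFieldTheory.Balaban1983to89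
open Literature.MathematicalPhysics.QuantumFieldTheory.Balaban1983to89.B5Prop11Plancherel (Cst Cst_nonneg Tor fine)
open Literature.MathematicalPhysics.QuantumFieldTheory.Balaban1983to89.B5G183RateUnitTower (lev lev_neZero)
open Literature.MathematicalPhysics.QuantumFieldTheory.Balaban1983to89.T4OutputRate
open Literature.MathematicalPhysics.QuantumFieldTheory.Balaban1983to89.T4InputCauchyRateData
open Literature.MathematicalPhysics.QuantumFieldTheory.Balaban1983to89.T4OperatorRateLiaison
open Literature.MathematicalPhysics.QuantumFieldTheory.Balaban1983to89.T4EtaRateMin (Readings LocalRate NE3Shape)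
open Summit.QuantumFields.BalabanUV.T4Continuum
open Summit.QuantumFields.BalabanUV.T4Continuum.CovariantAveragingTower
open Summit.QuantumFields.BalabanUV.T4Continuum.BackgroundResolventTower
open Summit.QuantumFields.BalabanUV.T4Continuum.OutputRateInsertion
open Summit.QuantumFields.BalabanUV.T4Continuum.OutputRateTowerSocket
open Summit.QuantumFields.BalabanUV.T4Continuum.OutputRateTowerInstance
open Summit.QuantumFields.BalabanUV.T4Continuum.BalabanAveragedTowerUnit (idx Qlev)
open Summit.QuantumFields.BalabanUV.T4Continuum.KingPairingPlantedLaw (calDalev JpcT CJ CJ_nonneg)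
open Summit.QuantumFields.BalabanUV.T4Continuum.GramPerturbationLaw (C2gram)
open Summit.QuantumFields.BalabanUV.T4Continuum.NE2FromNE3 (bgReadings)
open Summit.QuantumFields.BalabanUV.T4Continuum.NE2ColourPerturbedLayer (freeTowerLaws_king_kron pow_d_pos)
open Summit.QuantumFields.BalabanUV.T4Continuum.CovariantAveragingSummand (kappaQ kappaQ_ofReal)
open Summit.QuantumFields.BalabanUV.T4Continuum.RegularBackgroundTower (RegularTransporters regClass betaNE3)
open Summit.QuantumFields.BalabanUV.T4Continuum.GaugeTermScalarData (QuT Q1)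
open Summit.QuantumFields.BalabanUV.T4Continuum.RegularSiteTransporters (siteT)
open Summit.QuantumFields.BalabanUV.T4Continuum.NestedContourTransport (theta0)
open Summit.QuantumFields.BalabanUV.T4Continuum.NE2BalabanRoot (balabanPert)
open Summit.QuantumFields.BalabanUV.T4Continuum.NE2BalabanGauge (gaugeSlot liftR)
open Summit.QuantumFields.BalabanUV.T4Continuum.NE2BalabanLayerSharp (kappaBs C2Bs KstarR)
open Summit.QuantumFields.BalabanUV.T4Continuum.NE2BalabanWiring (epsR CdeltaR epsR_nonneg)
open Summit.QuantumFields.BalabanUV.T4Continuum.NE2BalabanFinal (tauR kappa4F C4F)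
open Summit.QuantumFields.BalabanUV.T4Continuum.NE2BalabanFinalRate (perturbationLaws_balaban_final_rate)
open Summit.QuantumFields.BalabanUV.T4Continuum.NE2BalabanThreshold (etaStar smallness_of_le)
open Summit.QuantumFields.BalabanUV.T4Continuum.NE2FromNE3Carrier (ne2Loc)
open Summit.QuantumFields.BalabanUV.T4Continuum.NE2BalabanFromNE3 (localRate_regClass_of_minActReadings localRate_minActReadings_iff)
open Summit.QuantumFields.BalabanUV.T4Continuum.OutputRateTowerBalaban (norm_one_mul_kappaBs_lt_one_of_regular)
open Summit.QuantumFields.BalabanUV.T4Continuum.NE2BalabanFinalRateCarriers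
  (max_rate_window inv_le_one_of_one_le_L towerLaw_balaban_final_of_regular_rate towerLaw_balaban_final_of_minActReadings_rate)
open Summit.QuantumFields.BalabanUV.T4Continuum.MinimalActionRate (minActReadings)

variable {d : ℕ} (L : ℕ) [NeZero L] (M : Fin d → ℕ) [hM : ∀ μ, NeZero (M μ)] (a : ℝ) (ha : 0 < a)
variable {o : Type*} [Fintype o] [DecidableEq o]

/-! ## §0 Two numeric facts used by every face -/

section Numeric

variable {Rg : (k : ℕ) → Fin d → (Tor (fine (lev L k) M) → Matrix o o ℂ)} {α β C θ a' η : ℝ}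

include ha in
/-- `0 ≤ C₂^B`: the consistency constant of ROOT B's `PerturbationLaws` is non-negative as soon as ONE member of the (3.35)-class with node
NE3's `LocalRate … C θ` at some rate `θ ∈ [L⁻¹, 1]` is at hand — read off PART 4's law `perturbationLaws_balaban_final_rate` (consistency clause
at `k = 0`; the argument is inlined at `θ = L⁻¹` in `OutputRateTowerBalaban`, stated once here at a general rate).  [folklore] -/
theorem C2Bs_nonneg_of_member_rate (hd : 1 ≤ d) (hreg : RegularTransporters L M (liftR L M Rg) α β) (hα : 0 ≤ α) (hβ : 0 ≤ β)
    (hC : 0 ≤ C) (hθ : ((L : ℝ)⁻¹) ≤ θ) (hθle : θ ≤ 1) (hNE3θ : LocalRate (bgReadings L M (regClass L M (liftR L M Rg))) C θ)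
    (ha' : 0 < a') (hαη : α ≤ η) (hβη : β ≤ η) (hη : η ≤ etaStar o d a a') :
    0 ≤ C2Bs o d L a α β C
      (a * C2gram (Cst d a) 1 (epsR o d α) (2 * d * Cst d a) (CJ d a) (Cst d a) (CdeltaR o d a α (theta0 d α (betaNE3 o C))))
      (C4F o d L a a' α β C) := by
  obtain ⟨h1, h2, -, -, -, -, -, -⟩ := smallness_of_le (o := o) (d := d) a ha.le ha' hα hβ hαη hβη hη
  have hP := perturbationLaws_balaban_final_rate L M a ha hd hreg hC hθ hθle hNE3θ ha' h1 h2
  have h0 := (norm_nonneg _).trans (hP.consistent_le 0)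
  simpa using h0

include ha in
/-- `0 ≤ Cpert(κ_B, 2dCst, CJ, C₂^B, 0, 1)` — row NE5's W1 constant for the operator of record is non-negative (under the one explicit
threshold, `‖1‖κ_B < 1` being `OutputRateTowerBalaban.norm_one_mul_kappaBs_lt_one_of_regular`).  [folklore] -/
theorem Cpert_balaban_nonneg_rate (hd : 1 ≤ d) (hreg : RegularTransporters L M (liftR L M Rg) α β) (hα : 0 ≤ α) (hβ : 0 ≤ β)
    (hC : 0 ≤ C) (hθ : ((L : ℝ)⁻¹) ≤ θ) (hθle : θ ≤ 1) (hNE3θ : LocalRate (bgReadings L M (regClass L M (liftR L M Rg))) C θ)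
    (ha' : 0 < a') (hαη : α ≤ η) (hβη : β ≤ η) (hη : η ≤ etaStar o d a a') :
    0 ≤ Cpert (kappaBs o d a α β (a * (epsR o d α * (2 + epsR o d α) * Cst d a)) (kappa4F d a a' α β))
        (2 * d * Cst d a) (CJ d a)
        (C2Bs o d L a α β C
          (a * C2gram (Cst d a) 1 (epsR o d α) (2 * d * Cst d a) (CJ d a) (Cst d a) (CdeltaR o d a α (theta0 d α (betaNE3 o C))))
          (C4F o d L a a' α β C)) 0 1 := by
  have ht := norm_one_mul_kappaBs_lt_one_of_regular (o := o) (d := d) a ha.le ha' hα hβ hαη hβη hη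
  have hC₀ : (0 : ℝ) ≤ 2 * d * Cst d a := by have := Cst_nonneg d a; positivity
  exact Cpert_nonneg ht hC₀ (CJ_nonneg d a) (C2Bs_nonneg_of_member_rate L M a ha hd hreg hα hβ hC hθ hθle hNE3θ ha' hαη hβη hη) le_rfl

end Numeric

/-! ## §1 Row NE5's END for Bałaban's typed tier-B operator at a general rate -/

section EndFace

variable {Jx : Type*} {Rg : Jx → ((k : ℕ) → Fin d → (Tor (fine (lev L k) M) → Matrix o o ℂ))} {α β C θ a' η : ℝ}
variable {Cr : Carriers} {Op Hist : Type*} [NormedAddCommGroup Op] [NormedSpace ℂ Op] [NormedAddCommGroup Hist]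
  [NormedSpace ℂ Hist] [CompleteSpace Hist] (Mdl : StepModel Cr Op Hist)

/-- **ROW NE5's END FOR BAŁABAN's TYPED TIER-B OPERATOR AT A GENERAL RATE `θ ∈ [L⁻¹, 1]`.**  For operator species an instantiation reads
(`ReadsTower`, constant `cR`) from the lifted King-averaged towers of `(Δ_a^{(k)} ⊗ 1 + P_B(Rg j)_k)⁻¹` over a nonempty family `Rg j` (DATA) of
site-based transporter towers in row B5's (3.35)-class with common sizes `α, β ≤ η ≤ etaStar o d a a′`, node NE3's `LocalRate … C θ` per member
(OPEN, displayed) at ANY rate `L⁻¹ ≤ θ ≤ 1`, `a′ > 0`: NE5 at every output rate `θ′ ∈ [θ, 1]` with `ω + Λc < θ′` follows from the reading, the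
[I]-type floor, MI-R, W2, W2-ins (+ `InsBoundA`), W3, `ReadsIns`, R, S — the socket's `ne5_at_of_towerLaw_lip_readsIns_nat` with W1 := PART 5's
`towerLaw_balaban_final_of_regular_rate` BY NAME, constant `δ = cR·Cpert(κ_B, 2dCst, CJ, C₂^B, 0, 1)∕r₀`.
`OutputRateTowerBalaban.ne5_at_of_balaban_lip_readsIns_nat` is the case `θ = L⁻¹`.  Model level (no B0); NE5 ∕ NE2 ∕ NE3 NOT proved. [folklore] -/
theorem ne5_at_of_balaban_lip_readsIns_rate_nat (Ins : ℕ → Op → (Cr.Dom → ℝ) → Hist) (hJ : Nonempty Jx) (hd : 1 ≤ d)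
    (hreg : ∀ j, RegularTransporters L M (liftR L M (Rg j)) α β) (hα : 0 ≤ α) (hβ : 0 ≤ β) (hC : 0 ≤ C)
    (hθ : ((L : ℝ)⁻¹) ≤ θ) (hθle : θ ≤ 1)
    (hNE3θ : ∀ j, LocalRate (bgReadings L M (regClass L M (liftR L M (Rg j)))) C θ) (ha' : 0 < a')
    (hαη : α ≤ η) (hβη : β ≤ η) (hη : η ≤ etaStar o d a a')
    {W : Set (ℕ → ℝ)} {cR r₀ δ : ℝ} {tow : ℕ → (ℕ → ℝ) → Cr.BgB → Jx} {EA : Functional Cr Cr.BgA} {EB : Functional Cr Cr.BgB}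
    {κ Λ EA₀ E₀ Gi θ' c ω ρ₀ ρ₁ Bc : ℝ} {k₀ k₁ : ℕ}
    (hread : ReadsTower Mdl (fun _ : Jx => fun k => Qlev L M k ⊗ₖ (1 : Matrix o o ℂ))
      (pertTower (fun k => calDalev L M a ha k ⊗ₖ (1 : Matrix o o ℂ))
        (fun j => balabanPert L M a (liftR L M (Rg j)) (gaugeSlot L M (Rg j) (QuT L M o (siteT L M (Rg j))) (Q1 L M o) a')) 1)
      ((L : ℝ) ^ d) W cR tow)
    (hcR : 0 ≤ cR) (hfl : ∀ k, r₀ ≤ Mdl.rOp k) (hr₀ : 0 < r₀)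
    (hδ : cR * Cpert (kappaBs o d a α β (a * (epsR o d α * (2 + epsR o d α) * Cst d a)) (kappa4F d a a' α β))
        (2 * d * Cst d a) (CJ d a)
        (C2Bs o d L a α β C
          (a * C2gram (Cst d a) 1 (epsR o d α) (2 * d * Cst d a) (CJ d a) (Cst d a) (CdeltaR o d a α (theta0 d α (betaNE3 o C))))
          (C4F o d L a a' α β C)) 0 1 / r₀ = δ)
    (hrA : Mdl.RepresentsA EA W) (hrB : Mdl.RepresentsB EB W) (hbase : Mdl.InBase EB W) (hlip : Mdl.DataLipschitz W κ Λ ρ₀)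
    (hdA : DecayBound EA W EA₀ κ) (hdB : DecayBound EB W E₀ κ) (hreadI : (InsOpModel.ofStep Mdl Ins).ReadsIns W)
    (hienv : (InsOpModel.ofStep Mdl Ins).InsOpEnvelope W κ E₀ Gi) (hbdA : (InsOpModel.ofStep Mdl Ins).InsBoundA W κ E₀ Gi)
    (hGi : 0 ≤ Gi) (hρ₁ : ρ₁ < 1) (hreach : δ * θ ^ k₁ ≤ ρ₁) (hdamp : Mdl.InsertionDampedNat W κ c ω) (hΛ : 0 ≤ Λ)
    (hθθ' : θ ≤ θ') (hθ'1 : θ' ≤ 1) (hc : 0 ≤ c) (hω : 0 < ω)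
    (hnear : (δ + (Gi * δ / (1 - ρ₁) + 2 * Gi / θ ^ k₁)) * θ ^ k₀ + c * (EA₀ + E₀) / (1 - ω) ≤ ρ₀)
    (hBc : 0 ≤ Bc) (hfirst : ∀ k < k₀, EA₀ + E₀ ≤ Bc * θ ^ k) (hsmall : ω + Λ * c < θ') :
    NE5 EA EB W κ θ'
      ((Λ * (δ + (Gi * δ / (1 - ρ₁) + 2 * Gi / θ ^ k₁)) + Bc) * (θ' - ω) / (θ' - (ω + Λ * c))) := by
  have hL : (0 : ℝ) < L := by exact_mod_cast Nat.pos_of_ne_zero (NeZero.ne L)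
  have hθ0 : 0 < θ := lt_of_lt_of_le (inv_pos.mpr hL) hθ
  have hlaw := towerLaw_balaban_final_of_regular_rate L M a ha hd hreg hα hβ hC hθ hθle hNE3θ ha' hαη hβη hη
  obtain ⟨j⟩ := hJ
  have hCp := Cpert_balaban_nonneg_rate L M a ha hd (hreg j) hα hβ hC hθ hθle (hNE3θ j) ha' hαη hβη hη
  subst hδ
  exact ne5_at_of_towerLaw_lip_readsIns_nat Mdl Ins (pow_d_pos (d := d) L)
    (towerContracting_perturbed (freeTowerLaws_king_kron L M a ha o)) hlaw hread hcR hCp hfl hr₀ hrA hrB hbase hlip hdA hdB hreadI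
    hienv hbdA hGi hρ₁ hreach hdamp hΛ hθ0 hθθ' hθ'1 hc hω hnear hBc hfirst hsmall

/-- **ROW NE5's END FOR BAŁABAN's TYPED TIER-B OPERATOR, ANY-RATE FACE** (`0 ≤ θ ≤ 1`): node NE3's `LocalRate … C θ` per member at ANY honest
rate ⟹ NE5 at every output rate `θ′ ∈ [max θ L⁻¹, 1]` with `ω + Λc < θ′`, every reach ∕ first-levels binder read at the input rate `max θ L⁻¹`
(an NE3 supply faster than King's free defects is capped at `L⁻¹`, a slower one passes through — PART 5's `max_rate_window`).  [folklore] -/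
theorem ne5_at_of_balaban_lip_readsIns_anyRate_nat (Ins : ℕ → Op → (Cr.Dom → ℝ) → Hist) (hJ : Nonempty Jx) (hd : 1 ≤ d)
    (hreg : ∀ j, RegularTransporters L M (liftR L M (Rg j)) α β) (hα : 0 ≤ α) (hβ : 0 ≤ β) (hC : 0 ≤ C)
    (hθ0 : 0 ≤ θ) (hθle : θ ≤ 1)
    (hNE3θ : ∀ j, LocalRate (bgReadings L M (regClass L M (liftR L M (Rg j)))) C θ) (ha' : 0 < a')
    (hαη : α ≤ η) (hβη : β ≤ η) (hη : η ≤ etaStar o d a a')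
    {W : Set (ℕ → ℝ)} {cR r₀ δ : ℝ} {tow : ℕ → (ℕ → ℝ) → Cr.BgB → Jx} {EA : Functional Cr Cr.BgA} {EB : Functional Cr Cr.BgB}
    {κ Λ EA₀ E₀ Gi θ' c ω ρ₀ ρ₁ Bc : ℝ} {k₀ k₁ : ℕ}
    (hread : ReadsTower Mdl (fun _ : Jx => fun k => Qlev L M k ⊗ₖ (1 : Matrix o o ℂ))
      (pertTower (fun k => calDalev L M a ha k ⊗ₖ (1 : Matrix o o ℂ))
        (fun j => balabanPert L M a (liftR L M (Rg j)) (gaugeSlot L M (Rg j) (QuT L M o (siteT L M (Rg j))) (Q1 L M o) a')) 1)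
      ((L : ℝ) ^ d) W cR tow)
    (hcR : 0 ≤ cR) (hfl : ∀ k, r₀ ≤ Mdl.rOp k) (hr₀ : 0 < r₀)
    (hδ : cR * Cpert (kappaBs o d a α β (a * (epsR o d α * (2 + epsR o d α) * Cst d a)) (kappa4F d a a' α β))
        (2 * d * Cst d a) (CJ d a)
        (C2Bs o d L a α β C
          (a * C2gram (Cst d a) 1 (epsR o d α) (2 * d * Cst d a) (CJ d a) (Cst d a) (CdeltaR o d a α (theta0 d α (betaNE3 o C))))
          (C4F o d L a a' α β C)) 0 1 / r₀ = δ)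
    (hrA : Mdl.RepresentsA EA W) (hrB : Mdl.RepresentsB EB W) (hbase : Mdl.InBase EB W) (hlip : Mdl.DataLipschitz W κ Λ ρ₀)
    (hdA : DecayBound EA W EA₀ κ) (hdB : DecayBound EB W E₀ κ) (hreadI : (InsOpModel.ofStep Mdl Ins).ReadsIns W)
    (hienv : (InsOpModel.ofStep Mdl Ins).InsOpEnvelope W κ E₀ Gi) (hbdA : (InsOpModel.ofStep Mdl Ins).InsBoundA W κ E₀ Gi)
    (hGi : 0 ≤ Gi) (hρ₁ : ρ₁ < 1) (hreach : δ * (max θ ((L : ℝ)⁻¹)) ^ k₁ ≤ ρ₁) (hdamp : Mdl.InsertionDampedNat W κ c ω)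
    (hΛ : 0 ≤ Λ) (hθθ' : max θ ((L : ℝ)⁻¹) ≤ θ') (hθ'1 : θ' ≤ 1) (hc : 0 ≤ c) (hω : 0 < ω)
    (hnear : (δ + (Gi * δ / (1 - ρ₁) + 2 * Gi / (max θ ((L : ℝ)⁻¹)) ^ k₁)) * (max θ ((L : ℝ)⁻¹)) ^ k₀
      + c * (EA₀ + E₀) / (1 - ω) ≤ ρ₀)
    (hBc : 0 ≤ Bc) (hfirst : ∀ k < k₀, EA₀ + E₀ ≤ Bc * (max θ ((L : ℝ)⁻¹)) ^ k) (hsmall : ω + Λ * c < θ') :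
    NE5 EA EB W κ θ'
      ((Λ * (δ + (Gi * δ / (1 - ρ₁) + 2 * Gi / (max θ ((L : ℝ)⁻¹)) ^ k₁)) + Bc) * (θ' - ω) / (θ' - (ω + Λ * c))) :=
  ne5_at_of_balaban_lip_readsIns_rate_nat L M a ha Mdl Ins hJ hd hreg hα hβ hC (le_max_right _ _)
    (max_le hθle (inv_le_one_of_one_le_L L)) (fun j => (hNE3θ j).mono le_rfl hθ0 (le_max_left _ _) hC) ha' hαη hβη hη hread hcR
    hfl hr₀ hδ hrA hrB hbase hlip hdA hdB hreadI hienv hbdA hGi hρ₁ hreach hdamp hΛ hθθ' hθ'1 hc hω hnear hBc hfirst hsmall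

end EndFace

/-! ## §2 Row NE5's W1 by the minimiser split on node NE3's carrier, at a general rate and from node U1b's full shape -/

section Split

variable {𝒞 : ℕ → Set (B7Prop1Explicit.Site d → Fin d → (Matrix o o ℂ)ˣ)} {N : ℕ}
  {dom : Set (B7Prop1Explicit.Site d → Fin d → (Matrix o o ℂ)ˣ)}
  {Rg : (B7Prop1Explicit.Site d → Fin d → (Matrix o o ℂ)ˣ) → ((k : ℕ) → Fin d → (Tor (fine (lev L k) M) → Matrix o o ℂ))}
  {α β C θ a' η : ℝ}
variable {Cr : Carriers} {Op Hist : Type*} [NormedAddCommGroup Op] [NormedSpace ℂ Op] [NormedAddCommGroup Hist]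
  [NormedSpace ℂ Hist] (Mdl : StepModel Cr Op Hist)

/-- **ROW NE5's OPERATOR RATE (W1) FOR BAŁABAN's TYPED TIER-B OPERATOR BY THE MINIMISER SPLIT AT A GENERAL RATE `θ ∈ [L⁻¹, 1]`, ONE NE3-TYPE
HYPOTHESIS FEEDING BOTH LEGS** (`d ≥ 1`, `dom` nonempty): first leg = PART 5's `towerLaw_balaban_final_of_minActReadings_rate` (rate `θ`) read on
the pair (run A, `opMid`) (`ReadsTowerMid`, constant `cR`, margin floor `r₀`); second leg = operator Lipschitz in the background (`Λb·dist·rOp`) ×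
the minimiser distance dominated by ONE site-reading discrepancy (`hdom`) of THE SAME carrier `minActReadings d 𝒞 L N dom (ne2Loc L M (liftR ∘
Rg))` whose `LocalRate … C θ` (`hNE3`, node U1b's shape, OPEN, displayed) also feeds the first leg ⟹ `OperatorRate W (cR·Cpert(κ_B, 2dCst, CJ,
C₂^B, 0, 1)∕r₀ + Λb·C) θ` — the socket's `operatorRate_of_towerLaw_split` BY NAME.
`OutputRateTowerBalaban.operatorRate_of_balaban_split_minActReadings` is the case `θ = L⁻¹`.  NE5 ∕ NE2 ∕ NE3 NOT proved; `Rg` DATA (no B0).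
[folklore] -/
theorem operatorRate_of_balaban_split_minActReadings_rate (hne : dom.Nonempty) (hd : 1 ≤ d)
    (hreg : ∀ V ∈ dom, RegularTransporters L M (liftR L M (Rg V)) α β) (hα : 0 ≤ α) (hβ : 0 ≤ β) (hC : 0 ≤ C)
    (hθ : ((L : ℝ)⁻¹) ≤ θ) (hθle : θ ≤ 1)
    (hNE3 : LocalRate (minActReadings d 𝒞 L N dom (ne2Loc L M fun V => liftR L M (Rg V))) C θ) (ha' : 0 < a')
    (hαη : α ≤ η) (hβη : β ≤ η) (hη : η ≤ etaStar o d a a')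
    {W : Set (ℕ → ℝ)} {cR r₀ Λb : ℝ} {tow : ℕ → (ℕ → ℝ) → Cr.BgB → ↥dom} (opMid : (ℕ → ℝ) → Cr.BgB → ℕ → Op)
    (dist : ℕ → (ℕ → ℝ) → Cr.BgB → ℝ)
    (hread : ReadsTowerMid Mdl (fun _ : ↥dom => fun k => Qlev L M k ⊗ₖ (1 : Matrix o o ℂ))
      (pertTower (fun k => calDalev L M a ha k ⊗ₖ (1 : Matrix o o ℂ))
        (fun V : ↥dom => balabanPert L M a (liftR L M (Rg V)) (gaugeSlot L M (Rg V) (QuT L M o (siteT L M (Rg V))) (Q1 L M o) a')) 1)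
      ((L : ℝ) ^ d) W cR tow opMid)
    (hcR : 0 ≤ cR) (hfl : ∀ k, r₀ ≤ Mdl.rOp k) (hr₀ : 0 < r₀)
    (hLip : ∀ k, ∀ g ∈ W, ∀ (U : Cr.BgB), ‖opMid g U k - Mdl.opB g U k‖ ≤ Λb * dist k g U * Mdl.rOp k) (hΛb : 0 ≤ Λb)
    (hdom : ∀ k, ∀ g ∈ W, ∀ (U : Cr.BgB), ∃ V ∈ dom, ∃ x : Bool × NE2FromNE3.Site L M o,
      dist k g U ≤ |ne2Loc L M (fun V => liftR L M (Rg V)) (k + 1) V x - ne2Loc L M (fun V => liftR L M (Rg V)) k V x|) :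
    Mdl.OperatorRate W
      (cR * Cpert (kappaBs o d a α β (a * (epsR o d α * (2 + epsR o d α) * Cst d a)) (kappa4F d a a' α β))
        (2 * d * Cst d a) (CJ d a)
        (C2Bs o d L a α β C
          (a * C2gram (Cst d a) 1 (epsR o d α) (2 * d * Cst d a) (CJ d a) (Cst d a) (CdeltaR o d a α (theta0 d α (betaNE3 o C))))
          (C4F o d L a a' α β C)) 0 1 / r₀ + Λb * C) θ := by
  have hL : (0 : ℝ) < L := by exact_mod_cast Nat.pos_of_ne_zero (NeZero.ne L)
  have hθ0 : 0 ≤ θ := (inv_nonneg.mpr hL.le).trans hθ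
  obtain ⟨V₀, hV₀⟩ := hne
  have hCp := Cpert_balaban_nonneg_rate L M a ha hd (hreg V₀ hV₀) hα hβ hC hθ hθle
    ((localRate_minActReadings_iff L M).1 hNE3 V₀ hV₀) ha' hαη hβη hη
  exact operatorRate_of_towerLaw_split Mdl opMid dist (minActReadings d 𝒞 L N dom (ne2Loc L M fun V => liftR L M (Rg V)))
    (pow_d_pos (d := d) L) (towerContracting_perturbed (freeTowerLaws_king_kron L M a ha o))
    (towerLaw_balaban_final_of_minActReadings_rate L M a ha hd hreg hα hβ hC hθ hθle hNE3 ha' hαη hβη hη) hread hcR hCp hθ0 le_rfl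
    hfl hr₀ hLip hΛb hNE3 hdom

/-- **ROW NE5's OPERATOR RATE (W1) FROM NODE U1b's FULL SHAPE ON NE3's CARRIER — NO RATE BINDER, NO BINDER OF NE2 TYPE LEFT** (`d ≥ 1`, `dom`
nonempty): `NE3Shape (minActReadings …) C θ` (node U1b's registered shape: `0 ≤ θ < 1` and the pointwise `LocalRate`, OPEN, displayed) ⟹
`OperatorRate W (cR·Cpert∕r₀ + Λb·C) (max θ L⁻¹)` — the previous face at the rate `max θ L⁻¹ ∈ [L⁻¹, 1)` after `LocalRate.mono`. [folklore] -/
theorem operatorRate_of_balaban_split_ne3Shape (hne : dom.Nonempty) (hd : 1 ≤ d)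
    (hreg : ∀ V ∈ dom, RegularTransporters L M (liftR L M (Rg V)) α β) (hα : 0 ≤ α) (hβ : 0 ≤ β) (hC : 0 ≤ C)
    (hNE3 : NE3Shape (minActReadings d 𝒞 L N dom (ne2Loc L M fun V => liftR L M (Rg V))) C θ) (ha' : 0 < a')
    (hαη : α ≤ η) (hβη : β ≤ η) (hη : η ≤ etaStar o d a a')
    {W : Set (ℕ → ℝ)} {cR r₀ Λb : ℝ} {tow : ℕ → (ℕ → ℝ) → Cr.BgB → ↥dom} (opMid : (ℕ → ℝ) → Cr.BgB → ℕ → Op)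
    (dist : ℕ → (ℕ → ℝ) → Cr.BgB → ℝ)
    (hread : ReadsTowerMid Mdl (fun _ : ↥dom => fun k => Qlev L M k ⊗ₖ (1 : Matrix o o ℂ))
      (pertTower (fun k => calDalev L M a ha k ⊗ₖ (1 : Matrix o o ℂ))
        (fun V : ↥dom => balabanPert L M a (liftR L M (Rg V)) (gaugeSlot L M (Rg V) (QuT L M o (siteT L M (Rg V))) (Q1 L M o) a')) 1)
      ((L : ℝ) ^ d) W cR tow opMid)
    (hcR : 0 ≤ cR) (hfl : ∀ k, r₀ ≤ Mdl.rOp k) (hr₀ : 0 < r₀)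
    (hLip : ∀ k, ∀ g ∈ W, ∀ (U : Cr.BgB), ‖opMid g U k - Mdl.opB g U k‖ ≤ Λb * dist k g U * Mdl.rOp k) (hΛb : 0 ≤ Λb)
    (hdom : ∀ k, ∀ g ∈ W, ∀ (U : Cr.BgB), ∃ V ∈ dom, ∃ x : Bool × NE2FromNE3.Site L M o,
      dist k g U ≤ |ne2Loc L M (fun V => liftR L M (Rg V)) (k + 1) V x - ne2Loc L M (fun V => liftR L M (Rg V)) k V x|) :
    Mdl.OperatorRate W
      (cR * Cpert (kappaBs o d a α β (a * (epsR o d α * (2 + epsR o d α) * Cst d a)) (kappa4F d a a' α β))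
        (2 * d * Cst d a) (CJ d a)
        (C2Bs o d L a α β C
          (a * C2gram (Cst d a) 1 (epsR o d α) (2 * d * Cst d a) (CJ d a) (Cst d a) (CdeltaR o d a α (theta0 d α (betaNE3 o C))))
          (C4F o d L a a' α β C)) 0 1 / r₀ + Λb * C) (max θ ((L : ℝ)⁻¹)) :=
  operatorRate_of_balaban_split_minActReadings_rate L M a ha Mdl hne hd hreg hα hβ hC (le_max_right _ _)
    (max_le hNE3.rate_lt_one.le (inv_le_one_of_one_le_L L))
    (hNE3.pointwise.mono le_rfl hNE3.rate_nonneg (le_max_left _ _) hC) ha' hαη hβη hη opMid dist hread hcR hfl hr₀ hLip hΛb hdom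

end Split

/-! ## §3 Row NE5's END by the minimiser split on node NE3's carrier (W4 PRODUCED), at a general rate and from node U1b's full shape -/

section SplitEnd

variable {𝒞 : ℕ → Set (B7Prop1Explicit.Site d → Fin d → (Matrix o o ℂ)ˣ)} {N : ℕ}
  {dom : Set (B7Prop1Explicit.Site d → Fin d → (Matrix o o ℂ)ˣ)}
  {Rg : (B7Prop1Explicit.Site d → Fin d → (Matrix o o ℂ)ˣ) → ((k : ℕ) → Fin d → (Tor (fine (lev L k) M) → Matrix o o ℂ))}
  {α β C θ a' η : ℝ}
variable {Cr : Carriers} {Op Hist : Type*} [NormedAddCommGroup Op] [NormedSpace ℂ Op] [NormedAddCommGroup Hist]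
  [NormedSpace ℂ Hist] [CompleteSpace Hist] (Mdl : StepModel Cr Op Hist)

/-- **ROW NE5's END FOR BAŁABAN's TYPED TIER-B OPERATOR BY THE MINIMISER SPLIT AT A GENERAL RATE `θ ∈ [L⁻¹, 1]`, W4 PRODUCED** (`d ≥ 1`, `dom`
nonempty): §2's W1 (`δ = cR·Cpert∕r₀ + Λb·C`, abbreviated by `hδ`) turned into W4 by the same-data insertion reading (`ReadsIns` ∧ `InsOpEnvelope κ
E₀ Gi` ∧ `InsBoundA κ E₀ Gi` ∧ the insertion reach `δ·θ^{k₁} ≤ ρ₁ < 1`), then the Data leaf — the socket's `ne5_at_of_towerLaw_split_readsIns_nat`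
BY NAME with W1-law := PART 5's `towerLaw_balaban_final_of_minActReadings_rate`.  The upstream analytic binders displayed are node NE3's
`LocalRate (minActReadings …) C θ` (ONE hypothesis, both legs) and the background-Lipschitz leg `hLip`∕`hdom`; the rest are row NE5's leaves BY
NAME.  NE5 ∕ NE2 ∕ NE3 NOT proved; `Rg` DATA (no B0). [folklore] -/
theorem ne5_at_of_balaban_split_readsIns_rate_nat (Ins : ℕ → Op → (Cr.Dom → ℝ) → Hist) (hne : dom.Nonempty) (hd : 1 ≤ d)
    (hreg : ∀ V ∈ dom, RegularTransporters L M (liftR L M (Rg V)) α β) (hα : 0 ≤ α) (hβ : 0 ≤ β) (hC : 0 ≤ C)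
    (hθ : ((L : ℝ)⁻¹) ≤ θ) (hθle : θ ≤ 1)
    (hNE3 : LocalRate (minActReadings d 𝒞 L N dom (ne2Loc L M fun V => liftR L M (Rg V))) C θ) (ha' : 0 < a')
    (hαη : α ≤ η) (hβη : β ≤ η) (hη : η ≤ etaStar o d a a')
    {W : Set (ℕ → ℝ)} {cR r₀ Λb δ : ℝ} {tow : ℕ → (ℕ → ℝ) → Cr.BgB → ↥dom} (opMid : (ℕ → ℝ) → Cr.BgB → ℕ → Op)
    (dist : ℕ → (ℕ → ℝ) → Cr.BgB → ℝ) {EA : Functional Cr Cr.BgA} {EB : Functional Cr Cr.BgB}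
    {κ Λ EA₀ E₀ Gi θ' c ω ρ₀ ρ₁ Bc : ℝ} {k₀ k₁ : ℕ}
    (hread : ReadsTowerMid Mdl (fun _ : ↥dom => fun k => Qlev L M k ⊗ₖ (1 : Matrix o o ℂ))
      (pertTower (fun k => calDalev L M a ha k ⊗ₖ (1 : Matrix o o ℂ))
        (fun V : ↥dom => balabanPert L M a (liftR L M (Rg V)) (gaugeSlot L M (Rg V) (QuT L M o (siteT L M (Rg V))) (Q1 L M o) a')) 1)
      ((L : ℝ) ^ d) W cR tow opMid)
    (hcR : 0 ≤ cR) (hfl : ∀ k, r₀ ≤ Mdl.rOp k) (hr₀ : 0 < r₀)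
    (hLip : ∀ k, ∀ g ∈ W, ∀ (U : Cr.BgB), ‖opMid g U k - Mdl.opB g U k‖ ≤ Λb * dist k g U * Mdl.rOp k) (hΛb : 0 ≤ Λb)
    (hdom : ∀ k, ∀ g ∈ W, ∀ (U : Cr.BgB), ∃ V ∈ dom, ∃ x : Bool × NE2FromNE3.Site L M o,
      dist k g U ≤ |ne2Loc L M (fun V => liftR L M (Rg V)) (k + 1) V x - ne2Loc L M (fun V => liftR L M (Rg V)) k V x|)
    (hδ : cR * Cpert (kappaBs o d a α β (a * (epsR o d α * (2 + epsR o d α) * Cst d a)) (kappa4F d a a' α β))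
        (2 * d * Cst d a) (CJ d a)
        (C2Bs o d L a α β C
          (a * C2gram (Cst d a) 1 (epsR o d α) (2 * d * Cst d a) (CJ d a) (Cst d a) (CdeltaR o d a α (theta0 d α (betaNE3 o C))))
          (C4F o d L a a' α β C)) 0 1 / r₀ + Λb * C = δ)
    (hrA : Mdl.RepresentsA EA W) (hrB : Mdl.RepresentsB EB W) (hbase : Mdl.InBase EB W) (hlip : Mdl.DataLipschitz W κ Λ ρ₀)
    (hdA : DecayBound EA W EA₀ κ) (hdB : DecayBound EB W E₀ κ) (hreadI : (InsOpModel.ofStep Mdl Ins).ReadsIns W)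
    (hienv : (InsOpModel.ofStep Mdl Ins).InsOpEnvelope W κ E₀ Gi) (hbdA : (InsOpModel.ofStep Mdl Ins).InsBoundA W κ E₀ Gi)
    (hGi : 0 ≤ Gi) (hρ₁ : ρ₁ < 1) (hreach : δ * θ ^ k₁ ≤ ρ₁) (hdamp : Mdl.InsertionDampedNat W κ c ω) (hΛ : 0 ≤ Λ)
    (hθθ' : θ ≤ θ') (hθ'1 : θ' ≤ 1) (hc : 0 ≤ c) (hω : 0 < ω)
    (hnear : (δ + (Gi * δ / (1 - ρ₁) + 2 * Gi / θ ^ k₁)) * θ ^ k₀ + c * (EA₀ + E₀) / (1 - ω) ≤ ρ₀)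
    (hBc : 0 ≤ Bc) (hfirst : ∀ k < k₀, EA₀ + E₀ ≤ Bc * θ ^ k) (hsmall : ω + Λ * c < θ') :
    NE5 EA EB W κ θ'
      ((Λ * (δ + (Gi * δ / (1 - ρ₁) + 2 * Gi / θ ^ k₁)) + Bc) * (θ' - ω) / (θ' - (ω + Λ * c))) := by
  have hL : (0 : ℝ) < L := by exact_mod_cast Nat.pos_of_ne_zero (NeZero.ne L)
  have hθ0 : 0 < θ := lt_of_lt_of_le (inv_pos.mpr hL) hθ
  obtain ⟨V₀, hV₀⟩ := hne
  have hCp := Cpert_balaban_nonneg_rate L M a ha hd (hreg V₀ hV₀) hα hβ hC hθ hθle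
    ((localRate_minActReadings_iff L M).1 hNE3 V₀ hV₀) ha' hαη hβη hη
  exact ne5_at_of_towerLaw_split_readsIns_nat Mdl Ins opMid dist
    (minActReadings d 𝒞 L N dom (ne2Loc L M fun V => liftR L M (Rg V))) (pow_d_pos (d := d) L)
    (towerContracting_perturbed (freeTowerLaws_king_kron L M a ha o))
    (towerLaw_balaban_final_of_minActReadings_rate L M a ha hd hreg hα hβ hC hθ hθle hNE3 ha' hαη hβη hη) hread hcR hCp hθ0.le
    le_rfl hfl hr₀ hLip hΛb hNE3 hC hdom hδ hrA hrB hbase hlip hdA hdB hreadI hienv hbdA hGi hρ₁ hreach hdamp hΛ hθ0 hθθ' hθ'1 hc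
    hω hnear hBc hfirst hsmall

/-- **ROW NE5's END FROM NODE U1b's FULL SHAPE ON NE3's CARRIER — THE ONE UPSTREAM BINDER OF W1 TYPE IS `NE3Shape`** (`d ≥ 1`, `dom` nonempty):
`NE3Shape (minActReadings …) C θ` ⟹ NE5 at every output rate `θ′ ∈ [max θ L⁻¹, 1]` with `ω + Λc < θ′`, every reach ∕ first-levels binder read at
the input rate `max θ L⁻¹`; constant `(Λ(δ + Giδ∕(1 − ρ₁) + 2Gi∕(max θ L⁻¹)^{k₁}) + Bc)(θ′ − ω)∕(θ′ − (ω + Λc))`.  On the tower-reading road this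
is row NE5's END with NO rate hypothesis and NO hypothesis of NE2 type: rows NE2's ROOT B ∕ PART 4 ∕ PART 5 are consumed BY NAME.  NE5 ∕ NE2 ∕
NE3 NOT proved; `Rg` DATA (no B0); not the END-of-record road (entry currency). [folklore] -/
theorem ne5_at_of_balaban_split_readsIns_ne3Shape_nat (Ins : ℕ → Op → (Cr.Dom → ℝ) → Hist) (hne : dom.Nonempty) (hd : 1 ≤ d)
    (hreg : ∀ V ∈ dom, RegularTransporters L M (liftR L M (Rg V)) α β) (hα : 0 ≤ α) (hβ : 0 ≤ β) (hC : 0 ≤ C)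
    (hNE3 : NE3Shape (minActReadings d 𝒞 L N dom (ne2Loc L M fun V => liftR L M (Rg V))) C θ) (ha' : 0 < a')
    (hαη : α ≤ η) (hβη : β ≤ η) (hη : η ≤ etaStar o d a a')
    {W : Set (ℕ → ℝ)} {cR r₀ Λb δ : ℝ} {tow : ℕ → (ℕ → ℝ) → Cr.BgB → ↥dom} (opMid : (ℕ → ℝ) → Cr.BgB → ℕ → Op)
    (dist : ℕ → (ℕ → ℝ) → Cr.BgB → ℝ) {EA : Functional Cr Cr.BgA} {EB : Functional Cr Cr.BgB}
    {κ Λ EA₀ E₀ Gi θ' c ω ρ₀ ρ₁ Bc : ℝ} {k₀ k₁ : ℕ}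
    (hread : ReadsTowerMid Mdl (fun _ : ↥dom => fun k => Qlev L M k ⊗ₖ (1 : Matrix o o ℂ))
      (pertTower (fun k => calDalev L M a ha k ⊗ₖ (1 : Matrix o o ℂ))
        (fun V : ↥dom => balabanPert L M a (liftR L M (Rg V)) (gaugeSlot L M (Rg V) (QuT L M o (siteT L M (Rg V))) (Q1 L M o) a')) 1)
      ((L : ℝ) ^ d) W cR tow opMid)
    (hcR : 0 ≤ cR) (hfl : ∀ k, r₀ ≤ Mdl.rOp k) (hr₀ : 0 < r₀)
    (hLip : ∀ k, ∀ g ∈ W, ∀ (U : Cr.BgB), ‖opMid g U k - Mdl.opB g U k‖ ≤ Λb * dist k g U * Mdl.rOp k) (hΛb : 0 ≤ Λb)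
    (hdom : ∀ k, ∀ g ∈ W, ∀ (U : Cr.BgB), ∃ V ∈ dom, ∃ x : Bool × NE2FromNE3.Site L M o,
      dist k g U ≤ |ne2Loc L M (fun V => liftR L M (Rg V)) (k + 1) V x - ne2Loc L M (fun V => liftR L M (Rg V)) k V x|)
    (hδ : cR * Cpert (kappaBs o d a α β (a * (epsR o d α * (2 + epsR o d α) * Cst d a)) (kappa4F d a a' α β))
        (2 * d * Cst d a) (CJ d a)
        (C2Bs o d L a α β C
          (a * C2gram (Cst d a) 1 (epsR o d α) (2 * d * Cst d a) (CJ d a) (Cst d a) (CdeltaR o d a α (theta0 d α (betaNE3 o C))))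
          (C4F o d L a a' α β C)) 0 1 / r₀ + Λb * C = δ)
    (hrA : Mdl.RepresentsA EA W) (hrB : Mdl.RepresentsB EB W) (hbase : Mdl.InBase EB W) (hlip : Mdl.DataLipschitz W κ Λ ρ₀)
    (hdA : DecayBound EA W EA₀ κ) (hdB : DecayBound EB W E₀ κ) (hreadI : (InsOpModel.ofStep Mdl Ins).ReadsIns W)
    (hienv : (InsOpModel.ofStep Mdl Ins).InsOpEnvelope W κ E₀ Gi) (hbdA : (InsOpModel.ofStep Mdl Ins).InsBoundA W κ E₀ Gi)
    (hGi : 0 ≤ Gi) (hρ₁ : ρ₁ < 1) (hreach : δ * (max θ ((L : ℝ)⁻¹)) ^ k₁ ≤ ρ₁) (hdamp : Mdl.InsertionDampedNat W κ c ω)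
    (hΛ : 0 ≤ Λ) (hθθ' : max θ ((L : ℝ)⁻¹) ≤ θ') (hθ'1 : θ' ≤ 1) (hc : 0 ≤ c) (hω : 0 < ω)
    (hnear : (δ + (Gi * δ / (1 - ρ₁) + 2 * Gi / (max θ ((L : ℝ)⁻¹)) ^ k₁)) * (max θ ((L : ℝ)⁻¹)) ^ k₀
      + c * (EA₀ + E₀) / (1 - ω) ≤ ρ₀)
    (hBc : 0 ≤ Bc) (hfirst : ∀ k < k₀, EA₀ + E₀ ≤ Bc * (max θ ((L : ℝ)⁻¹)) ^ k) (hsmall : ω + Λ * c < θ') :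
    NE5 EA EB W κ θ'
      ((Λ * (δ + (Gi * δ / (1 - ρ₁) + 2 * Gi / (max θ ((L : ℝ)⁻¹)) ^ k₁)) + Bc) * (θ' - ω) / (θ' - (ω + Λ * c))) :=
  ne5_at_of_balaban_split_readsIns_rate_nat L M a ha Mdl Ins hne hd hreg hα hβ hC (le_max_right _ _)
    (max_le hNE3.rate_lt_one.le (inv_le_one_of_one_le_L L))
    (hNE3.pointwise.mono le_rfl hNE3.rate_nonneg (le_max_left _ _) hC) ha' hαη hβη hη opMid dist hread hcR hfl hr₀ hLip hΛb hdom
    hδ hrA hrB hbase hlip hdA hdB hreadI hienv hbdA hGi hρ₁ hreach hdamp hΛ hθθ' hθ'1 hc hω hnear hBc hfirst hsmall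

end SplitEnd

end Summit.QuantumFields.BalabanUV.T4Continuum.OutputRateTowerBalabanRate

end
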